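import Mathlib
import HarnessLib
import Summits.HubbardSuperconductivity.HubbardSuperconductivity.Theorems.KLProgrammeFermiSurfaceSharpRange

/-!
# Route `KLProgramme` (K1 `H10TwoPointLimit`, K3 `KLRegimeTwoPointLimit`) — the SHARP `BandBounds` bundle, named

Cell `gate-hubbard-kl`, seat fs-1 (g4), risk r2 (serving r1 «explicit constants»). The one DEFINITION of the sharp
envelope series: `klfsSharpBandBounds ha hab hb : BandSectorCounting.BandBounds a b` for a level range
`-4 < a ≤ b < 0`, the term whose existence is `klfs_exists_sharpBandBounds` (`KLProgrammeFermiSurfaceSharpRange.lean`),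
with its eight fields in closed form (`d_μ = arccos(-μ/4)`, `K_μ = umklappRadius μ`, `s_μ = √(-μ(4+μ))/2`,
`s_* = min(s_a, s_b)`, `n_μ = (-μ/2)(1 - μ²/16)`, `κ_μ = -μ/√(32 - 2μ²)`):

  `umin = √2 d_a`, `smax = √2 K_b`, `A2 = √2 (K_b²/s_* + 2 K_b)`, `hmin = min(n_a, n_b)/(sin d_a/d_a)²`,
  `amin = κ_b (√2 d_a)`, `rhomin = s_*`, `cmax = sin d_a/d_a`, `Dtmin = max(√2 s_*, 2 (sin K_b/K_b)(√2 d_a))`.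

It is a drop-in replacement for the tree's generic `bandBounds a b` in every consumer that quantifies over
`B : BandBounds a b` (`count_pairs_exists`, `kltb_exists_angular_bound`, p4's perturbed / relative / offset counts):
same structure, same proof obligations, constants three to four orders of magnitude closer to the truth near the
van Hove level (FS-WINDOW.md §6; on the certified window `C_g`: `5.2·10⁴ → 94.3`). The field equations are
`klfsSharpBandBounds_umin` … `_Dtmin` (by `rfl`). One definition (review lane); no new mathematics beyond part 4.
[folklore]
-/

noncomputable section

open Real Set

-- the tree's namespace `Summit.<Summit>.<Problem>.Theorems` repeats the summit name by design (D-0017)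
set_option linter.dupNamespace false

namespace Summit.HubbardSuperconductivity.HubbardSuperconductivity.Theorems

open Literature.MathematicalPhysics.QuantumLattice
open Literature.MathematicalPhysics.QuantumLattice.BandSectorCounting

section Range

variable {a b : ℝ} (ha : -4 < a) (hab : a ≤ b) (hb : b < 0)

/-- **The SHARP bundle of uniform constants of the band Fermi curve on `[a, b] ⊂ (-4, 0)`** — the window-specific
replacement of the generic `bandBounds a b`, every field in closed form (module docstring). [folklore] -/
def klfsSharpBandBounds : BandBounds a b where
  ha := ha
  hb := hb
  umin := Real.sqrt 2 * Real.arccos (-a / 4)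
  smax := Real.sqrt 2 * umklappRadius b
  A2 := Real.sqrt 2 * (umklappRadius b ^ 2 /
    min (Real.sqrt (-a * (4 + a)) / 2) (Real.sqrt (-b * (4 + b)) / 2) + 2 * umklappRadius b)
  hmin := min (-a / 2 * (1 - a ^ 2 / 16)) (-b / 2 * (1 - b ^ 2 / 16)) /
    (Real.sin (Real.arccos (-a / 4)) / Real.arccos (-a / 4)) ^ 2
  amin := -b / Real.sqrt (32 - 2 * b ^ 2) * (Real.sqrt 2 * Real.arccos (-a / 4))
  rhomin := min (Real.sqrt (-a * (4 + a)) / 2) (Real.sqrt (-b * (4 + b)) / 2)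
  cmax := Real.sin (Real.arccos (-a / 4)) / Real.arccos (-a / 4)
  Dtmin := max (Real.sqrt 2 * min (Real.sqrt (-a * (4 + a)) / 2) (Real.sqrt (-b * (4 + b)) / 2))
    (2 * cQ b * (Real.sqrt 2 * Real.arccos (-a / 4)))
  umin_pos := mul_pos (Real.sqrt_pos.2 (by norm_num)) (klfs_arccos_quarter_pos_lt ha hab hb).1
  smax_pos := mul_pos (Real.sqrt_pos.2 (by norm_num)) (umklappRadius_pos (by linarith))
  A2_pos := by
    have hK : 0 < umklappRadius b := umklappRadius_pos (by linarith)
    have hs := klfs_levelSin_min_pos ha hab hb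
    positivity
  hmin_pos := by
    obtain ⟨hd0, hdlt⟩ := klfs_arccos_quarter_pos_lt ha hab hb
    exact div_pos (klfs_levelN_min_pos ha hab hb)
      (pow_pos (div_pos (Real.sin_pos_of_pos_of_lt_pi hd0 (by linarith [Real.pi_pos])) hd0) 2)
  amin_pos := by
    have hκb : 0 < -b / Real.sqrt (32 - 2 * b ^ 2) := div_pos (by linarith) (Real.sqrt_pos.2 (by nlinarith))
    have hd := (klfs_arccos_quarter_pos_lt ha hab hb).1
    positivity
  rhomin_pos := klfs_levelSin_min_pos ha hab hb
  cmax_pos := by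
    obtain ⟨hd0, hdlt⟩ := klfs_arccos_quarter_pos_lt ha hab hb
    exact div_pos (Real.sin_pos_of_pos_of_lt_pi hd0 (by linarith [Real.pi_pos])) hd0
  Dtmin_pos := by
    have hs := klfs_levelSin_min_pos ha hab hb
    exact lt_max_of_lt_left (by positivity)
  umin_le := fun _ hμ θ => klfs_sharp_umin_le ha hb hμ θ
  abs_VX_le := fun _ hμ θ => klfs_sharp_abs_bandVX_le ha hb hμ θ
  abs_VY_le := fun _ hμ θ => klfs_sharp_abs_bandVY_le ha hb hμ θ
  abs_AX_le := fun _ hμ θ => klfs_sharp_abs_bandAX_le ha hab hb hμ θ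
  abs_AY_le := fun _ hμ θ => klfs_sharp_abs_bandAY_le ha hab hb hμ θ
  hess_ge := fun _ hμ θ => klfs_sharp_hess_ge ha hab hb hμ θ
  gauss := fun _ hμ θ θ' => klfs_sharp_gauss_expand ha hab hb hμ θ θ'
  rho_ge := fun _ hμ θ => klfs_sharp_rho_ge ha hb hμ θ
  c_le := fun _ hμ θ => klfs_sharp_bandNormalCoeff_le ha hab hb hμ θ
  Dt_ge := fun _ hμ θ => klfs_sharp_Dt_ge ha hab hb hμ θ

/-- `umin = √2 d_a`. [folklore] -/
theorem klfsSharpBandBounds_umin : (klfsSharpBandBounds ha hab hb).umin = Real.sqrt 2 * Real.arccos (-a / 4) := rfl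

/-- `smax = √2 K_b`. [folklore] -/
theorem klfsSharpBandBounds_smax : (klfsSharpBandBounds ha hab hb).smax = Real.sqrt 2 * umklappRadius b := rfl

/-- `A2 = √2 (K_b²/s_* + 2 K_b)`. [folklore] -/
theorem klfsSharpBandBounds_A2 : (klfsSharpBandBounds ha hab hb).A2 = Real.sqrt 2 * (umklappRadius b ^ 2 /
    min (Real.sqrt (-a * (4 + a)) / 2) (Real.sqrt (-b * (4 + b)) / 2) + 2 * umklappRadius b) := rfl

/-- `hmin = min(n_a, n_b)/(sin d_a/d_a)²`. [folklore] -/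
theorem klfsSharpBandBounds_hmin : (klfsSharpBandBounds ha hab hb).hmin =
    min (-a / 2 * (1 - a ^ 2 / 16)) (-b / 2 * (1 - b ^ 2 / 16)) /
      (Real.sin (Real.arccos (-a / 4)) / Real.arccos (-a / 4)) ^ 2 := rfl

/-- `amin = κ_b √2 d_a`. [folklore] -/
theorem klfsSharpBandBounds_amin : (klfsSharpBandBounds ha hab hb).amin =
    -b / Real.sqrt (32 - 2 * b ^ 2) * (Real.sqrt 2 * Real.arccos (-a / 4)) := rfl

/-- `rhomin = s_*`. [folklore] -/
theorem klfsSharpBandBounds_rhomin : (klfsSharpBandBounds ha hab hb).rhomin =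
    min (Real.sqrt (-a * (4 + a)) / 2) (Real.sqrt (-b * (4 + b)) / 2) := rfl

/-- `cmax = sin d_a / d_a`. [folklore] -/
theorem klfsSharpBandBounds_cmax : (klfsSharpBandBounds ha hab hb).cmax =
    Real.sin (Real.arccos (-a / 4)) / Real.arccos (-a / 4) := rfl

/-- `Dtmin = max(√2 s_*, 2 (sin K_b/K_b) √2 d_a)`. [folklore] -/
theorem klfsSharpBandBounds_Dtmin : (klfsSharpBandBounds ha hab hb).Dtmin =
    max (Real.sqrt 2 * min (Real.sqrt (-a * (4 + a)) / 2) (Real.sqrt (-b * (4 + b)) / 2))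
      (2 * cQ b * (Real.sqrt 2 * Real.arccos (-a / 4))) := rfl

/-- The Gauss constant of the sharp bundle in closed form:
`C_g = π (sin d_a/d_a) / (2 κ_b √2 d_a · s_*²)`. [folklore] -/
theorem klfsSharpBandBounds_Cg : (klfsSharpBandBounds ha hab hb).Cg =
    π * (Real.sin (Real.arccos (-a / 4)) / Real.arccos (-a / 4)) /
      (2 * (-b / Real.sqrt (32 - 2 * b ^ 2) * (Real.sqrt 2 * Real.arccos (-a / 4))) *
        min (Real.sqrt (-a * (4 + a)) / 2) (Real.sqrt (-b * (4 + b)) / 2) ^ 2) := rfl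

end Range

end Summit.HubbardSuperconductivity.HubbardSuperconductivity.Theorems

end
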